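import Literature.AlgebraicGeometry.Resolution.HilbertSamuelStrata
import Literature.RingTheory.HilbertSamuel.Quotient
import HarnessLib

/-!
# Hilbert–Samuel functions are local: invariance under isomorphisms of local rings, open
# immersions and isomorphisms of schemes (CJS 2020, Def. 2.28)

Topic: `Literature/AlgebraicGeometry/Resolution`. The Hilbert–Samuel function
`H_X(x) = H^{(φ_X(x))}_{𝒪_{X,x}}` of Cossart–Jannsen–Saito (LNM 2270, Def. 2.28) depends only on
the local ring `𝒪_{X,x}` (through `H^{(0)}_{𝒪_{X,x}}` and `ψ_X(x) = min{dim 𝒪_{X,x}/𝔭}`), a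
tacit convention used throughout the source (e.g. Def. 6.15 (ME1) "isomorphism over
`X − X_max`", Rem. 6.13, and every passage to an open neighbourhood). For the tree's
`Scheme.hsFun` (`HilbertSamuelStrata.lean`) we PROVE:

* `minimalPrimesCodim_eq_of_ringEquiv`, `hilbertSamuelFun_eq_of_ringEquiv` — `ψ` and `H^{(t)}`
  are invariant under isomorphisms of (noetherian local) rings;
* `Scheme.hsFun_eq_of_isIso_stalkMap` — if `f : X → Y` induces an isomorphism
  `𝒪_{Y,f(x)} ≅ 𝒪_{X,x}` then `H_X^N(x) = H_Y^N(f(x))` (same for `ψ`, `φ`); in particular for open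
  immersions and isomorphisms (`Scheme.hsFun_eq_of_isOpenImmersion`), so that
  `Σ_X ⊆ Σ_Y` for `X ↪ Y` open (`Scheme.hsValues_subset_of_isOpenImmersion`), `Σ_X = Σ_Y` for
  `X ≅ Y` (`Scheme.hsValues_eq_of_isIso`), and the strata pull back
  (`Scheme.preimage_hsStratum_of_isOpenImmersion`).

## Sources

* V. Cossart, U. Jannsen, S. Saito, LNM 2270 (2020), Def. 2.28, Def. 2.35.
  [CossartJannsenSaito2020]
-/

noncomputable section

open CategoryTheory AlgebraicGeometry TopologicalSpace IsLocalRing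

namespace Literature.RingTheory.HilbertSamuel

universe u v

/-- Minimal primes and the dimensions of their quotients correspond under a ring isomorphism.
[folklore] -/
theorem exists_minimalPrimes_ringKrullDim_quotient_eq_of_ringEquiv {A : Type u} {B : Type v}
    [CommRing A] [CommRing B] (e : A ≃+* B) {q : Ideal B} (hq : q ∈ minimalPrimes B) :
    ∃ p ∈ minimalPrimes A, ringKrullDim (A ⧸ p) = ringKrullDim (B ⧸ q) := by
  have h : minimalPrimes B = Ideal.comap e.symm.toRingHom '' minimalPrimes A := by
    have h1 := Ideal.comap_minimalPrimes_eq_of_surjective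
      (f := e.symm.toRingHom) e.symm.surjective (⊥ : Ideal A)
    rwa [Ideal.comap_bot_of_injective e.symm.toRingHom e.symm.injective] at h1
  rw [h] at hq
  obtain ⟨p, hp, rfl⟩ := hq
  have hpe : Ideal.comap e.symm.toRingHom p = Ideal.map (e : A →+* B) p := by
    rw [Ideal.map_comap_of_equiv]
    rfl
  refine ⟨p, hp, ?_⟩
  rw [hpe]
  exact ringKrullDim_eq_of_ringEquiv (Ideal.quotientEquiv p _ e rfl)

/-- **`ψ` is invariant under ring isomorphisms.** [folklore] -/
theorem minimalPrimesCodim_eq_of_ringEquiv {A : Type u} {B : Type v} [CommRing A] [CommRing B]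
    (e : A ≃+* B) : minimalPrimesCodim A = minimalPrimesCodim B := by
  unfold minimalPrimesCodim
  congr 1
  ext n
  constructor
  · rintro ⟨p, hp, hn⟩
    obtain ⟨q, hq, hqn⟩ := exists_minimalPrimes_ringKrullDim_quotient_eq_of_ringEquiv e.symm hp
    exact ⟨q, hq, hqn.trans hn⟩
  · rintro ⟨q, hq, hn⟩
    obtain ⟨p, hp, hpn⟩ := exists_minimalPrimes_ringKrullDim_quotient_eq_of_ringEquiv e hq
    exact ⟨p, hp, hpn.trans hn⟩

/-- **`H^{(t)}` is invariant under isomorphisms of noetherian local rings.** [folklore] -/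
theorem hilbertSamuelFun_eq_of_ringEquiv {A : Type u} {B : Type v} [CommRing A] [CommRing B]
    [IsLocalRing A] [IsLocalRing B] [IsNoetherianRing A] (e : A ≃+* B) (t : ℕ) :
    hilbertSamuelFun A t = hilbertSamuelFun B t := by
  show iterPSum t (hilbertFun A) = iterPSum t (hilbertFun B)
  rw [hilbertFun_eq_of_ringEquiv e]

end Literature.RingTheory.HilbertSamuel

namespace Literature.AlgebraicGeometry.Resolution

open Literature.RingTheory.HilbertSamuel

universe u

variable {X Y : Scheme.{u}} (f : X ⟶ Y)

/-- `ψ_X(x) = ψ_Y(f(x))` when `f` induces an isomorphism of local rings at `x`. [folklore] -/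
theorem Scheme.hsPsi_eq_of_isIso_stalkMap (x : X) [IsIso (f.stalkMap x)] :
    Scheme.hsPsi X x = Scheme.hsPsi Y (f.base x) :=
  (minimalPrimesCodim_eq_of_ringEquiv (asIso (f.stalkMap x)).commRingCatIsoToRingEquiv).symm

/-- `φ_X^N(x) = φ_Y^N(f(x))` when `f` induces an isomorphism of local rings at `x`. [folklore] -/
theorem Scheme.hsPhi_eq_of_isIso_stalkMap (N : ℕ) (x : X) [IsIso (f.stalkMap x)] :
    Scheme.hsPhi X N x = Scheme.hsPhi Y N (f.base x) := by
  rw [Scheme.hsPhi, Scheme.hsPhi, Scheme.hsPsi_eq_of_isIso_stalkMap f x]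

/-- **`H_X^N(x) = H_Y^N(f(x))` when `f` induces an isomorphism `𝒪_{Y,f(x)} ≅ 𝒪_{X,x}`**: the
Hilbert–Samuel function of CJS Def. 2.28 depends only on the local ring.
[cite: CossartJannsenSaito2020, Def. 2.28] -/
theorem Scheme.hsFun_eq_of_isIso_stalkMap [IsLocallyNoetherian Y] (N : ℕ) (x : X)
    [IsIso (f.stalkMap x)] : Scheme.hsFun X N x = Scheme.hsFun Y N (f.base x) := by
  rw [Scheme.hsFun, Scheme.hsFun, Scheme.hsPhi_eq_of_isIso_stalkMap f N x]
  exact (hilbertSamuelFun_eq_of_ringEquiv (asIso (f.stalkMap x)).commRingCatIsoToRingEquiv _).symm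

/-- **Open immersions (in particular isomorphisms and open subschemes) preserve the
Hilbert–Samuel function.** [cite: CossartJannsenSaito2020, Def. 2.28] -/
theorem Scheme.hsFun_eq_of_isOpenImmersion [IsLocallyNoetherian Y] [IsOpenImmersion f] (N : ℕ)
    (x : X) : Scheme.hsFun X N x = Scheme.hsFun Y N (f.base x) :=
  Scheme.hsFun_eq_of_isIso_stalkMap f N x

/-- `H_U^N = H_X^N|_U` for an open subscheme `U ⊆ X`. [cite: CossartJannsenSaito2020, Def. 2.28] -/
theorem Scheme.hsFun_opens [IsLocallyNoetherian X] (U : X.Opens) (N : ℕ) (u : U) :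
    Scheme.hsFun (U : Scheme.{u}) N u = Scheme.hsFun X N (U.ι.base u) :=
  Scheme.hsFun_eq_of_isOpenImmersion U.ι N u

/-- `Σ_X ⊆ Σ_Y` for an open immersion `X ↪ Y`. [cite: CossartJannsenSaito2020, Def. 2.35] -/
theorem Scheme.hsValues_subset_of_isOpenImmersion [IsLocallyNoetherian Y] [IsOpenImmersion f]
    (N : ℕ) : Scheme.hsValues X N ⊆ Scheme.hsValues Y N := by
  rintro _ ⟨x, rfl⟩
  exact ⟨f.base x, (Scheme.hsFun_eq_of_isOpenImmersion f N x).symm⟩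

/-- **`Σ_X = Σ_Y` for isomorphic schemes.** [cite: CossartJannsenSaito2020, Def. 2.35] -/
theorem Scheme.hsValues_eq_of_isIso [IsLocallyNoetherian Y] [IsIso f] (N : ℕ) :
    Scheme.hsValues X N = Scheme.hsValues Y N := by
  refine (Scheme.hsValues_subset_of_isOpenImmersion f N).antisymm ?_
  rintro _ ⟨y, rfl⟩
  obtain ⟨x, rfl⟩ := f.surjective y
  exact ⟨x, Scheme.hsFun_eq_of_isOpenImmersion f N x⟩

/-- The Hilbert–Samuel strata pull back along open immersions: `f⁻¹(Y(ν)) = X(ν)`.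
[cite: CossartJannsenSaito2020, Def. 2.28 (4)] -/
theorem Scheme.preimage_hsStratum_of_isOpenImmersion [IsLocallyNoetherian Y] [IsOpenImmersion f]
    (N : ℕ) (ν : ℕ → ℕ) : f.base ⁻¹' Scheme.hsStratum Y N ν = Scheme.hsStratum X N ν := by
  ext x
  simp only [Set.mem_preimage, Scheme.hsStratum, Set.mem_setOf_eq,
    Scheme.hsFun_eq_of_isOpenImmersion f N x]

/-- The loci `X(≥ ν)` pull back along open immersions. [cite: CossartJannsenSaito2020, Def. 2.28 (4)] -/
theorem Scheme.preimage_hsStratumGE_of_isOpenImmersion [IsLocallyNoetherian Y]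
    [IsOpenImmersion f] (N : ℕ) (ν : ℕ → ℕ) :
    f.base ⁻¹' Scheme.hsStratumGE Y N ν = Scheme.hsStratumGE X N ν := by
  ext x
  simp only [Set.mem_preimage, Scheme.hsStratumGE, Set.mem_setOf_eq,
    Scheme.hsFun_eq_of_isOpenImmersion f N x]

end Literature.AlgebraicGeometry.Resolution

end
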